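import Summits.RiemannHypothesis.RiemannHypothesis.Theses.WeilGroundState
import Summits.RiemannHypothesis.RiemannHypothesis.Theorems.WeilGroundStateGroundStatesConvergeToXiLineExactMoments
import Summits.RiemannHypothesis.RiemannHypothesis.Theorems.WeilGroundStateGroundStatesConvergeToXiRenormLowerBound
import Summits.RiemannHypothesis.RiemannHypothesis.Theorems.WeilGroundStateGroundStatesConvergeToXiOverlapCriterion
import Summits.RiemannHypothesis.RiemannHypothesis.Theorems.WeilGroundStateGroundStatesConvergeToXiZeroSideOffLine
import Summits.RiemannHypothesis.RiemannHypothesis.Theorems.WeilGroundStateGroundStatesConvergeToXiFrequentlySimpleEven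
import Literature.NumberTheory.LFunctions.RiemannXiHadamardProduct
import HarnessLib

/-!
# `WeilGroundState.GroundStatesConvergeToXi` — the counterexample world of a crux witness
(crux item stmt-RiemannHypothesis-1527, route route-RiemannHypothesis-WeilGroundState; line `Sketch`,
lead c5; `--supports`; a one-statement census of leads c2–c5)

RH-free.  `not_riemannHypothesis_cruxWitness_portrait` collects in ONE theorem what every
witness `(a_k, u_k, c_k)` of the crux (ground states `u_k` at `a_k → ∞`, `c_k · weilMellin u_k → ξ`
locally uniformly on the open strip) must look like if the Riemann Hypothesis FAILS:
(1) the renormalisation blows up, `‖c_k‖ → ∞` (c3); (2) the normalised transforms collapse,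
`û_k → 0` locally uniformly on the strip (c3); (3) the normalised ground states become mean-free,
`∫ u_k → 0` (c5), and (4) lose every moment, `∫ u_k tⁿ → 0` (c5); (5) they become orthogonal to
the window kernels, `⟨u_k, φ_{a_k}⟩ → 0` (c2/c5); (6) their renormalised `L¹` mass is unbounded
(c2); (7) no witness window has a simple-even bottom, cofinitely (c3); (8) `ζ` has infinitely
many zeros off the critical line, of unbounded height (c4).  The contrapositive
`riemannHypothesis_or_portrait_of_groundStatesConvergeToXi` is the sharpest form of
"crux ⇒ RH" proved in the tree: the crux implies RH unless ALL of (1)–(8) hold for its witness.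
No new definitions, no new analysis — bookkeeping over landed theorems.
-/

noncomputable section

set_option linter.dupNamespace false

open scoped Topology Real ComplexConjugate
open Filter Set MeasureTheory Complex

namespace Summit.RiemannHypothesis.RiemannHypothesis.Theorems.GroundStatesConvergeToXi

open Literature.NumberTheory.LFunctions

/-- **Portrait of a crux witness in the counterexample world (RH-free census).**  Under `¬RH`,
every witness of the crux's convergence clause has: `‖c_k‖ → ∞`; `û_k → 0` locally uniformly on
the open strip; `∫u_k → 0`; all moments `∫u_k tⁿ → 0`; overlaps with the window kernels
`⟨u_k, φ_{a_k}⟩ → 0`; unbounded renormalised `L¹` mass; no simple-even bottom at its windows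
cofinitely; and infinitely many off-line zeros of `ζ`, of unbounded height. [folklore] -/
theorem not_riemannHypothesis_cruxWitness_portrait (hRH : ¬ RiemannHypothesis)
    {a : ℕ → ℝ} {u : ℕ → ℝ → ℂ} {c : ℕ → ℂ}
    (ha : Tendsto a atTop atTop) (hu : ∀ k, IsWeilGroundState (a k) (u k))
    (hlim : TendstoLocallyUniformlyOn (fun k s => c k * weilMellin (u k) s) riemannXi atTop
      {s : ℂ | 0 < s.re ∧ s.re < 1}) :
    Tendsto (fun k => ‖c k‖) atTop atTop ∧
    TendstoLocallyUniformlyOn (fun k s => weilMellin (u k) s) (0 : ℂ → ℂ) atTop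
      {s : ℂ | 0 < s.re ∧ s.re < 1} ∧
    Tendsto (fun k => ∫ t, u k t) atTop (𝓝 0) ∧
    (∀ n : ℕ, Tendsto (fun k => ∫ t, u k t * (t : ℂ) ^ n) atTop (𝓝 0)) ∧
    Tendsto (fun k => ∫ t, u k t * conj ((2 : ℂ) * LagariasMontague.Psic (2 * t) *
      ((Literature.Analysis.Calculus.cutoff (a k) t : ℝ) : ℂ))) atTop (𝓝 0) ∧
    (∀ M : ℝ, ∃ k, M < ∫ t, ‖c k * u k t‖) ∧
    (∀ᶠ k in atTop, ¬ WeilWindowSimpleEven (a k)) ∧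
    {ρ : ℂ | ρ ∈ ZetaZeros.riemannZetaNontrivialZeros ∧ ρ.re ≠ 1 / 2}.Infinite ∧
    (∀ T : ℝ, ∃ ρ : ℂ, ρ ∈ ZetaZeros.riemannZetaNontrivialZeros ∧ ρ.re ≠ 1 / 2 ∧ T < |ρ.im|) := by
  have hc : ∀ᶠ k in atTop, c k ≠ 0 := by
    filter_upwards [(tendsto_renorm_integral hlim).eventually_ne riemannXi_one_half_ne_zero] with k hk
    exact left_ne_zero_of_mul hk
  refine ⟨tendsto_norm_atTop_of_not_riemannHypothesis hRH ha hu hlim,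
    tendstoLocallyUniformlyOn_weilMellin_zero_of_not_riemannHypothesis hRH ha hu hlim,
    tendsto_integral_zero_of_not_riemannHypothesis hRH ha hu hlim,
    fun n => tendsto_moment_zero_of_not_riemannHypothesis hRH ha hu hlim n, ?_,
    integral_norm_unbounded_of_not_riemannHypothesis hRH ha hu hlim,
    eventually_not_windowSimpleEven_of_not_riemannHypothesis hRH hu hc hlim,
    offLine_infinite_of_not_riemannHypothesis hRH ha hu hlim,
    exists_offLine_im_gt_of_not_riemannHypothesis hRH ha hu hlim⟩
  -- overlaps: uniformly small over ALL ground states at large windows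
  rw [tendsto_zero_iff_norm_tendsto_zero, Metric.tendsto_nhds]
  intro δ hδ
  filter_upwards [ha.eventually (eventually_norm_overlap_le_of_not_riemannHypothesis' hRH (half_pos hδ))]
    with k hk
  rw [dist_zero_right, Real.norm_of_nonneg (norm_nonneg _)]
  exact lt_of_le_of_lt (hk (u k) (hu k)) (half_lt_self hδ)

/-- **The crux implies RH unless its witness lives in the counterexample world** (contrapositive,
RH-free): `GroundStatesConvergeToXi → RH ∨ ∃ witness with properties (1)–(8)`. [folklore] -/
theorem riemannHypothesis_or_portrait_of_groundStatesConvergeToXi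
    (h : Summit.RiemannHypothesis.RiemannHypothesis.Theses.WeilGroundState.GroundStatesConvergeToXi) :
    RiemannHypothesis ∨
      ∃ a : ℕ → ℝ, ∃ u : ℕ → ℝ → ℂ, ∃ c : ℕ → ℂ, Tendsto a atTop atTop ∧
        (∀ k, IsWeilGroundState (a k) (u k)) ∧
        TendstoLocallyUniformlyOn (fun k s => c k * weilMellin (u k) s) riemannXi atTop
          {s : ℂ | 0 < s.re ∧ s.re < 1} ∧
        Tendsto (fun k => ‖c k‖) atTop atTop ∧
        TendstoLocallyUniformlyOn (fun k s => weilMellin (u k) s) (0 : ℂ → ℂ) atTop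
          {s : ℂ | 0 < s.re ∧ s.re < 1} ∧
        Tendsto (fun k => ∫ t, u k t) atTop (𝓝 0) ∧
        (∀ n : ℕ, Tendsto (fun k => ∫ t, u k t * (t : ℂ) ^ n) atTop (𝓝 0)) ∧
        Tendsto (fun k => ∫ t, u k t * conj ((2 : ℂ) * LagariasMontague.Psic (2 * t) *
          ((Literature.Analysis.Calculus.cutoff (a k) t : ℝ) : ℂ))) atTop (𝓝 0) ∧
        (∀ M : ℝ, ∃ k, M < ∫ t, ‖c k * u k t‖) ∧
        (∀ᶠ k in atTop, ¬ WeilWindowSimpleEven (a k)) ∧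
        {ρ : ℂ | ρ ∈ ZetaZeros.riemannZetaNontrivialZeros ∧ ρ.re ≠ 1 / 2}.Infinite ∧
        (∀ T : ℝ, ∃ ρ : ℂ, ρ ∈ ZetaZeros.riemannZetaNontrivialZeros ∧ ρ.re ≠ 1 / 2 ∧ T < |ρ.im|) := by
  by_cases hRH : RiemannHypothesis
  · exact Or.inl hRH
  · obtain ⟨a, u, c, ha, hk, hlim⟩ := h
    have hu : ∀ k, IsWeilGroundState (a k) (u k) := fun k => ⟨(hk k).2.2.1, (hk k).2.2.2⟩
    exact Or.inr ⟨a, u, c, ha, hu, hlim, not_riemannHypothesis_cruxWitness_portrait hRH ha hu hlim⟩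

end Summit.RiemannHypothesis.RiemannHypothesis.Theorems.GroundStatesConvergeToXi

end
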